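import Literature.Geometry.Kaehler.ComplexTorusCanonicalFactor
import Literature.Geometry.Kaehler.ComplexTorusPolarizationType
import Literature.Geometry.Kaehler.ComplexTorusEllipticCurve
import Mathlib.Analysis.InnerProductSpace.PiL2
import Mathlib.LinearAlgebra.SymplecticGroup
import Mathlib.LinearAlgebra.Matrix.SesquilinearForm
import Mathlib.LinearAlgebra.Complex.FiniteDimensional
import HarnessLib

/-!
# Adapted (unitary) symplectic real bases of a polarised complex vector space
# (Lange 2023, §2.1.1, §7.3.2)

Layer `Literature/Geometry/Kaehler`, namespace `Literature.Geometry.Kaehler.ComplexTorus`; lane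
`lit-hodgefound`, Layer A4, row **A4-38** of `run/shared/lean/pub/lit-hodgefound/SKELETON.md`
§A4-DETAIL (gap row of seat `lit-hodgefound-skel-4`, taken by prover `lit-hodgefound-p17`): the
linear algebra feeding Lemma 7.3.7 / Theorem 7.3.4 (row A4-36: an `Sp(V, E)`-stable subspace of
`(p,p)`-forms is pointwise `Sp`-fixed) — in an adapted symplectic basis multiplication by `i` is the
Weyl element `J⁻¹` of `Sp_{2g}(ℝ)` and "preserving `E`" is membership in Mathlib's
`Matrix.symplecticGroup`.

Source followed: H. Lange, *Abelian Varieties over the Complex Numbers*, Grundlehren Text Edition,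
Springer (2023), held copy `book:lange1992-complex-abelian-varieties` (this held text IS the 2023
edition, lane ruling of record):

* §1.2.2 Lemma 1.2.10 (p. 18): a hermitian form `H` and the real alternating form `E = Im H` with
  `E(iv, iw) = E(v, w)` determine each other, `H(v, w) = E(iv, w) + iE(v, w)` — the tree's
  `ComplexTorus.hermOf η` (`ℂ`-linear in the FIRST argument, `hermOf_swap`:
  `H(w, v) = \overline{H(v, w)}` for `η` of type `(1,1)`);
* §2.1.1 (pp. 75–76, held chunks p0075–p0076): "a polarization is by definition (the first Chern
  class of) a positive definite" `H`; for positive definite `H` the complex vector space `V` has an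
  `H`-ORTHONORMAL `ℂ`-basis `u₁, …, u_g` (Gram–Schmidt);
* §7.3.2 Lemma 7.3.7 (p. 338, chunk p0338 L21–L25): "Choose a decomposition `V = V⁺ ⊕ V⁻` into
  isotropic subvector spaces", the symplectic group `Sp(V, E) = Sp_{2g}(ℝ)` of the polarisation.

Given a real `2`-form `η` on a finite-dimensional complex vector space `E` of type `(1,1)` with
`η(iu, u) > 0` for `u ≠ 0` (the first and third clauses of the tree's `ComplexTorus.IsRiemannForm`),
an `H`-orthonormal `ℂ`-basis `u` (`exists_basis_hermOf_orthonormal`, obtained from Mathlib's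
`stdOrthonormalBasis` for the inner product space core `⟪u, v⟫ := H(v, u)` — no new structure is
registered globally) yields the REAL basis `e_a = i u_a`, `f_a = u_a` (`a = 1, …, g`) with
`η(e_a, f_b) = Re H(u_a, u_b) = δ_ab`, `η(e_a, e_b) = η(f_a, f_b) = Im H(u_a, u_b) = 0`, and
`i e_a = -f_a`, `i f_a = e_a`. In the coordinates `B : ℝ^g ⊕ ℝ^g ≃ E` of this basis
(`exists_adaptedSymplecticBasis`):

* `η(Bx, By) = -ᵗx J y` with Mathlib's `Matrix.J g ℝ = (0 -1; 1 0)`, and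
* multiplication by `i` is `x ↦ -Jx = J⁻¹x`;

consequently a real-linear `M : E → E` preserves `η` iff the matrix `A` of `B⁻¹ M B` satisfies
`ᵗA J A = J`, i.e. lies in `Matrix.symplecticGroup g ℝ` (`preserves_iff_mem_symplecticGroup`,
Mathlib `SymplecticGroup.mem_iff'`). Wrappers for `IsRiemannForm` and the validation
instance `g = 1`: for the elliptic curve `E_τ = ℂ/(ℤ + τℤ)` with its principal polarisation
`E(v, w) = Im(v w̄)/Im τ` one has `H(v, w) = v w̄ / Im τ` (`hermOf_ellipticForm`), the vector
`u₁ = √(Im τ)` is `H`-orthonormal and `(e₁, f₁) = (i√(Im τ), √(Im τ))` is an adapted symplectic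
basis (`ellipticForm_adaptedFrame`).

## Contents (theorems only; no definition, no named fact)

`hermOf_smul_right`, **`exists_basis_hermOf_orthonormal`**, **`exists_adaptedSymplecticBasis`**,
**`preserves_iff_mem_symplecticGroup`**, `toMatrix_I_smul_eq_neg_J`,
`neg_J_mem_symplecticGroup_of_adapted`, `IsRiemannForm.exists_basis_hermOf_orthonormal`,
`IsRiemannForm.exists_adaptedSymplecticBasis`, `hermOf_ellipticForm`, `hermOf_ellipticForm_sqrt_im`,
`ellipticForm_adaptedFrame`.

## References

* [Lange2023AbelianVarietiesComplex] H. Lange, *Abelian Varieties over the Complex Numbers* (2023),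
  §1.2.2 Lemma 1.2.10, §2.1.1 (positive definite `H`, pp. 75–76), §2.1.1 Example 2.1.3 (elliptic
  curves), §7.2.1 (`Sp(V, E) ≅ Sp_{2g}(ℝ)`, p. 330), §7.3.2 Lemma 7.3.7 (p. 338).
* [LangeBirkenhake1992] H. Lange, Ch. Birkenhake, *Complex Abelian Varieties* (1992), Lemma 2.1.7,
  §4.1 (the same material in the original Grundlehren volume).
-/

noncomputable section

open Complex Module Matrix
open scoped ComplexConjugate

namespace Literature.Geometry.Kaehler

namespace ComplexTorus

variable {E : Type*} [NormedAddCommGroup E] [NormedSpace ℂ E]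

/-! ### The hermitian form `H = hermOf η` of a positive `(1,1)`-form: orthonormal bases -/

section Orthonormal

variable (η : E [⋀^Fin 2]→L[ℝ] ℝ) (h11 : ∀ u v : E, η ![I • u, I • v] = η ![u, v])

include h11 in
/-- For `η` of type `(1,1)`, `H` is conjugate-linear in the second argument:
`H(v, c w) = c̄ H(v, w)` ("a hermitian form … is linear in the first argument and satisfies
`H(v, w) = \overline{H(w, v)}`"). [cite: Lange2023AbelianVarietiesComplex, §1.2.2 Lemma 1.2.10] -/
theorem hermOf_smul_right (c : ℂ) (v w : E) : hermOf η v (c • w) = conj c * hermOf η v w := by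
  rw [hermOf_swap η h11 (c • w) v, hermOf_smul_left, map_mul, ← hermOf_swap η h11 w v]

include h11 in
/-- **An `H`-orthonormal `ℂ`-basis** ("a polarization is by definition a positive definite
hermitian form `H`", §2.1.1; Gram–Schmidt): if `η` is of type `(1,1)` and `η(iu, u) > 0` for
`u ≠ 0`, the finite-dimensional complex vector space `E` has a `ℂ`-basis `u₁, …, u_g`
(`g = dim_ℂ E`) with `H(u_a, u_b) = δ_ab` for `H = hermOf η`. Obtained from Mathlib's
`stdOrthonormalBasis` for the inner product space core `⟪u, v⟫ := H(v, u)` on `E` (used locally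
only).
[cite: Lange2023AbelianVarietiesComplex, §2.1.1 (positive definite `H`, pp. 75–76)] -/
theorem exists_basis_hermOf_orthonormal [FiniteDimensional ℂ E]
    (hpos : ∀ u : E, u ≠ 0 → 0 < η ![I • u, u]) :
    ∃ u : Basis (Fin (finrank ℂ E)) ℂ E, ∀ a b, hermOf η (u a) (u b) = if a = b then 1 else 0 := by
  classical
  -- the inner product space core `⟪x, y⟫ := H(y, x)` (Mathlib's inner products are conjugate-linear
  -- in the first argument, `H` is linear in the first argument)
  let cd : InnerProductSpace.Core ℂ E :=
    { inner := fun x y ↦ hermOf η y x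
      conj_inner_symm := fun x y ↦ (hermOf_swap η h11 x y).symm
      re_inner_nonneg := fun x ↦ by
        change 0 ≤ (hermOf η x x).re
        rw [hermOf_re]
        by_cases hx : x = 0
        · rw [hx, smul_zero, twoForm_self]
        · exact (hpos x hx).le
      add_left := fun x y z ↦ hermOf_add_right η z x y
      smul_left := fun x y r ↦ hermOf_smul_right η h11 r y x
      definite := fun x (hx : hermOf η x x = 0) ↦ by
        by_contra hne
        have h := hpos x hne
        rw [← hermOf_re, hx, Complex.zero_re] at h
        exact lt_irrefl 0 h }
  -- Gram–Schmidt for this core (all instances passed explicitly: `E` keeps its own norm)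
  let b := @stdOrthonormalBasis ℂ _ E (@InnerProductSpace.Core.toNormedAddCommGroup ℂ E _ _ _ cd)
    (@InnerProductSpace.ofCore ℂ E _ _ _ cd.toCore) ‹FiniteDimensional ℂ E›
  have hb := (@orthonormal_iff_ite ℂ E _
    (@InnerProductSpace.Core.toNormedAddCommGroup ℂ E _ _ _ cd).toSeminormedAddCommGroup
    (@InnerProductSpace.ofCore ℂ E _ _ _ cd.toCore) _ _ _).1
    (@OrthonormalBasis.orthonormal _ ℂ _ E
      (@InnerProductSpace.Core.toNormedAddCommGroup ℂ E _ _ _ cd)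
      (@InnerProductSpace.ofCore ℂ E _ _ _ cd.toCore) _ b)
  have hcoe := @OrthonormalBasis.coe_toBasis _ ℂ _ E
    (@InnerProductSpace.Core.toNormedAddCommGroup ℂ E _ _ _ cd)
    (@InnerProductSpace.ofCore ℂ E _ _ _ cd.toCore) _ b
  refine ⟨@OrthonormalBasis.toBasis _ ℂ _ E
    (@InnerProductSpace.Core.toNormedAddCommGroup ℂ E _ _ _ cd)
    (@InnerProductSpace.ofCore ℂ E _ _ _ cd.toCore) _ b, fun a a' ↦ ?_⟩
  rw [hcoe]
  have h := hb a' a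
  change hermOf η (b a) (b a') = _ at h
  rw [h]
  simp only [eq_comm]

end Orthonormal

/-! ### The adapted symplectic real basis `(iu₁, …, iu_g, u₁, …, u_g)` -/

section Adapted

variable (η : E [⋀^Fin 2]→L[ℝ] ℝ) (h11 : ∀ u v : E, η ![I • u, I • v] = η ![u, v])

include h11 in
/-- **Adapted (unitary) symplectic real basis.** For `η` of type `(1,1)` with `η(iu, u) > 0`
(`u ≠ 0`) on a finite-dimensional complex `E` (`g = dim_ℂ E`) there is a real-linear isomorphism
`B : ℝ^g ⊕ ℝ^g ≃ E` — `B(x, y) = Σ x_a e_a + Σ y_a f_a` for the real basis `e_a = i u_a`,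
`f_a = u_a` built from an `H`-orthonormal `ℂ`-basis `u` (`exists_basis_hermOf_orthonormal`), so that
`η(e_a, f_b) = Re H(u_a, u_b) = δ_ab` and `η(e_a, e_b) = η(f_a, f_b) = Im H(u_a, u_b) = 0` — in
which `η(Bx, By) = -ᵗx J y` for Mathlib's `J = Matrix.J g ℝ = (0 -1_g; 1_g 0)` and multiplication by
`i` is `-J = J⁻¹` (`i e_a = -f_a`, `i f_a = e_a`). (Lemma 7.3.7: "Choose a decomposition
`V = V⁺ ⊕ V⁻` into isotropic subvector spaces"; here `ℝ`-isotropic: `Σ ℝe_a` and `Σ ℝf_a`.)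
[cite: Lange2023AbelianVarietiesComplex, §7.3.2 Lemma 7.3.7 (p. 338) and §2.1.1] -/
theorem exists_adaptedSymplecticBasis [FiniteDimensional ℂ E]
    (hpos : ∀ u : E, u ≠ 0 → 0 < η ![I • u, u]) :
    ∃ B : (Fin (finrank ℂ E) ⊕ Fin (finrank ℂ E) → ℝ) ≃L[ℝ] E,
      (∀ x y, η ![B x, B y] = -(x ⬝ᵥ (Matrix.J (Fin (finrank ℂ E)) ℝ *ᵥ y))) ∧
        ∀ x, I • B x = B (-(Matrix.J (Fin (finrank ℂ E)) ℝ *ᵥ x)) := by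
  classical
  obtain ⟨u, hu⟩ := exists_basis_hermOf_orthonormal η h11 hpos
  -- values of `η` on the frame
  have hre : ∀ a b, η ![I • u a, u b] = if a = b then 1 else 0 := fun a b ↦ by
    have h := congrArg Complex.re (hu a b)
    rw [hermOf_re] at h
    rw [h]
    split_ifs <;> simp
  have him : ∀ a b, η ![u a, u b] = 0 := fun a b ↦ by
    have h := congrArg Complex.im (hu a b)
    rw [hermOf_im] at h
    rw [h]
    split_ifs <;> simp
  -- the real frame `v = (iu, u)` is an `ℝ`-basis
  let v : Fin (finrank ℂ E) ⊕ Fin (finrank ℂ E) → E := Sum.elim (fun a ↦ I • u a) (fun a ↦ u a)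
  have hli : LinearIndependent ℝ v := by
    rw [Fintype.linearIndependent_iff]
    intro c hc
    rw [Fintype.sum_sum_type] at hc
    simp only [v, Sum.elim_inl, Sum.elim_inr] at hc
    have hc' : ∑ a, (((c (Sum.inr a) : ℝ) : ℂ) + ((c (Sum.inl a) : ℝ) : ℂ) * I) • u a = 0 := by
      rw [← hc, ← Finset.sum_add_distrib]
      refine Finset.sum_congr rfl fun a _ ↦ ?_
      rw [add_smul, mul_smul, Complex.coe_smul, Complex.coe_smul, add_comm]
    have h0 := Fintype.linearIndependent_iff.1 u.linearIndependent _ hc'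
    rintro (a | a)
    · have h := congrArg Complex.im (h0 a)
      simpa using h
    · have h := congrArg Complex.re (h0 a)
      simpa using h
  have hcard : Fintype.card (Fin (finrank ℂ E) ⊕ Fin (finrank ℂ E)) = finrank ℝ E := by
    rw [Fintype.card_sum, Fintype.card_fin, finrank_real_of_complex, two_mul]
  let b : Basis (Fin (finrank ℂ E) ⊕ Fin (finrank ℂ E)) ℝ E :=
    basisOfLinearIndependentOfCardEqFinrank' v hli hcard
  have hb : ⇑b = v := coe_basisOfLinearIndependentOfCardEqFinrank' v hli hcard
  let B : (Fin (finrank ℂ E) ⊕ Fin (finrank ℂ E) → ℝ) ≃L[ℝ] E :=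
    b.equivFun.symm.toContinuousLinearEquiv
  have hB : ∀ x, B x = ∑ i, x i • v i := fun x ↦ by
    change b.equivFun.symm x = _
    rw [Basis.equivFun_symm_apply, hb]
  -- the Gram matrix of `η` in the frame is `-J`
  have hgram : ∀ i j, η ![v i, v j] = -(Matrix.J (Fin (finrank ℂ E)) ℝ) i j := by
    rintro (a | a) (b | b)
    · simp only [v, Sum.elim_inl, Matrix.J, Matrix.fromBlocks_apply₁₁, Matrix.zero_apply, neg_zero,
        h11, him]
    · simp only [v, Sum.elim_inl, Sum.elim_inr, Matrix.J, Matrix.neg_apply,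
        Matrix.fromBlocks_apply₁₂, Matrix.one_apply, neg_neg, hre]
    · rw [twoForm_swap]
      simp only [v, Sum.elim_inl, Sum.elim_inr, Matrix.J, Matrix.fromBlocks_apply₂₁,
        Matrix.one_apply, hre, eq_comm]
    · simp only [v, Sum.elim_inr, Matrix.J, Matrix.fromBlocks_apply₂₂, Matrix.zero_apply, neg_zero,
        him]
  -- single coordinate vectors go to frame vectors
  have hBsingle : ∀ i, B (Pi.single i 1) = v i := fun i ↦ by
    rw [hB]
    simp [Pi.single_apply]
  refine ⟨B, fun x y ↦ ?_, fun x ↦ ?_⟩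
  · -- bilinear expansion through the matrix of the bilinear form `(x, y) ↦ η(Bx, By)`
    have hM : LinearMap.toMatrix₂' ℝ (latticeBilin B η) = -Matrix.J (Fin (finrank ℂ E)) ℝ := by
      ext i j
      rw [LinearMap.toMatrix₂'_apply, latticeBilin_apply, hBsingle, hBsingle, hgram,
        Matrix.neg_apply]
    have h2 : η ![B x, B y] =
        Matrix.toLinearMap₂' ℝ (LinearMap.toMatrix₂' ℝ (latticeBilin B η)) x y := by
      rw [Matrix.toLinearMap₂'_toMatrix', latticeBilin_apply]
    rw [h2, Matrix.toLinearMap₂'_apply', hM, Matrix.neg_mulVec, dotProduct_neg]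
  · -- multiplication by `i` is `-J`
    rw [hB, hB, Finset.smul_sum, Fintype.sum_sum_type, Fintype.sum_sum_type]
    simp only [v, Sum.elim_inl, Sum.elim_inr, Matrix.J, Pi.neg_apply, Matrix.fromBlocks_mulVec,
      Matrix.zero_mulVec, Matrix.neg_mulVec, Matrix.one_mulVec, zero_add, add_zero,
      neg_neg, Function.comp_apply, smul_comm (I : ℂ) (x _) (_ : E), smul_smul,
      Complex.I_mul_I, neg_smul, one_smul, smul_neg]
    rw [add_comm]

end Adapted

/-! ### Preserving `η` = membership in `Sp_{2g}(ℝ)` -/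

section Symplectic

variable (η : E [⋀^Fin 2]→L[ℝ] ℝ) {l : Type*} [Fintype l] [DecidableEq l]

/-- **`M` preserves `E` iff its matrix is symplectic.** In any real coordinates
`B : ℝ^l ⊕ ℝ^l ≃ E` in which `η(Bx, By) = -ᵗx J y` (e.g. an adapted symplectic basis,
`exists_adaptedSymplecticBasis`), a real-linear `M : E → E` preserves `η` iff the matrix `A` of
`B⁻¹ ∘ M ∘ B` satisfies `ᵗA J A = J`, i.e. `A ∈ Matrix.symplecticGroup l ℝ` — "`Sp_{2g}(V, E)` … the
symplectic group … isomorphic to `Sp_{2g}(ℝ)`" (§7.2.1, p. 330).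
[cite: Lange2023AbelianVarietiesComplex, §7.2.1 (p. 330)] -/
theorem preserves_iff_mem_symplecticGroup (B : (l ⊕ l → ℝ) ≃L[ℝ] E)
    (hB : ∀ x y, η ![B x, B y] = -(x ⬝ᵥ (Matrix.J l ℝ *ᵥ y))) (M : E →ₗ[ℝ] E) :
    (∀ u v, η ![M u, M v] = η ![u, v]) ↔
      LinearMap.toMatrix' ((B.symm.toLinearEquiv : E →ₗ[ℝ] (l ⊕ l → ℝ)) ∘ₗ M ∘ₗ
        (B.toLinearEquiv : (l ⊕ l → ℝ) →ₗ[ℝ] E)) ∈ Matrix.symplecticGroup l ℝ := by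
  set A := LinearMap.toMatrix' ((B.symm.toLinearEquiv : E →ₗ[ℝ] (l ⊕ l → ℝ)) ∘ₗ M ∘ₗ
    (B.toLinearEquiv : (l ⊕ l → ℝ) →ₗ[ℝ] E)) with hA_def
  have hA : ∀ x, M (B x) = B (A *ᵥ x) := fun x ↦ by
    rw [hA_def, LinearMap.toMatrix'_mulVec]
    simp
  have key : ∀ x y, η ![M (B x), M (B y)] = -(x ⬝ᵥ ((Aᵀ * Matrix.J l ℝ * A) *ᵥ y)) := fun x y ↦ by
    rw [hA, hA, hB, ← Matrix.mulVec_mulVec, ← Matrix.mulVec_mulVec, Matrix.dotProduct_mulVec x Aᵀ,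
      Matrix.vecMul_transpose]
  rw [SymplecticGroup.mem_iff']
  constructor
  · intro hM
    refine (Matrix.toLinearMap₂' ℝ (S₁ := ℝ) (S₂ := ℝ)).injective
      (LinearMap.ext fun x ↦ LinearMap.ext fun y ↦ ?_)
    rw [Matrix.toLinearMap₂'_apply', Matrix.toLinearMap₂'_apply']
    have h1 := key x y
    rw [hM, hB, neg_inj] at h1
    exact h1.symm
  · intro hA' u v
    obtain ⟨x, rfl⟩ := B.surjective u
    obtain ⟨y, rfl⟩ := B.surjective v
    rw [key, hA', hB]

/-- **Multiplication by `i` is the Weyl element `J⁻¹ = -J`** in adapted coordinates: if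
`i · Bx = B(-Jx)` (second clause of `exists_adaptedSymplecticBasis`), the matrix of the real-linear
map `B⁻¹ ∘ (i ·) ∘ B` is `-J = -Matrix.J l ℝ`.
[cite: Lange2023AbelianVarietiesComplex, §7.3.2 Lemma 7.3.7 (p. 338)] -/
theorem toMatrix_I_smul_eq_neg_J (B : (l ⊕ l → ℝ) ≃L[ℝ] E)
    (hBI : ∀ x, I • B x = B (-(Matrix.J l ℝ *ᵥ x))) :
    LinearMap.toMatrix' ((B.symm.toLinearEquiv : E →ₗ[ℝ] (l ⊕ l → ℝ)) ∘ₗ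
      ((LinearMap.lsmul ℂ E I).restrictScalars ℝ) ∘ₗ (B.toLinearEquiv : (l ⊕ l → ℝ) →ₗ[ℝ] E)) =
      -Matrix.J l ℝ := by
  have h : ((B.symm.toLinearEquiv : E →ₗ[ℝ] (l ⊕ l → ℝ)) ∘ₗ
      ((LinearMap.lsmul ℂ E I).restrictScalars ℝ) ∘ₗ (B.toLinearEquiv : (l ⊕ l → ℝ) →ₗ[ℝ] E)) =
      Matrix.toLin' (-Matrix.J l ℝ) := by
    refine LinearMap.ext fun x ↦ ?_
    rw [Matrix.toLin'_apply, Matrix.neg_mulVec]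
    simp [hBI]
  rw [h, LinearMap.toMatrix'_toLin']

/-- In adapted coordinates multiplication by `i` preserves `η` (type `(1,1)`), so `-J ∈ Sp_{2g}(ℝ)`
is the matrix of an element of `Sp(V, E)` — the element `h(i)` whose conjugates drive Lemma 7.3.7.
[cite: Lange2023AbelianVarietiesComplex, §7.3.2 Lemma 7.3.7 (p. 338)] -/
theorem neg_J_mem_symplecticGroup_of_adapted (h11 : ∀ u v : E, η ![I • u, I • v] = η ![u, v])
    (B : (l ⊕ l → ℝ) ≃L[ℝ] E) (hB : ∀ x y, η ![B x, B y] = -(x ⬝ᵥ (Matrix.J l ℝ *ᵥ y)))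
    (hBI : ∀ x, I • B x = B (-(Matrix.J l ℝ *ᵥ x))) :
    -Matrix.J l ℝ ∈ Matrix.symplecticGroup l ℝ := by
  rw [← toMatrix_I_smul_eq_neg_J B hBI]
  exact (preserves_iff_mem_symplecticGroup η B hB _).1 fun u v ↦ by
    simpa using h11 u v

/-- Non-vacuity of `preserves_iff_mem_symplecticGroup`: the identity preserves `η` and its matrix
`1` is symplectic. [cite: Lange2023AbelianVarietiesComplex, §7.2.1 (p. 330)] -/
example (B : (l ⊕ l → ℝ) ≃L[ℝ] E)
    (hB : ∀ x y, η ![B x, B y] = -(x ⬝ᵥ (Matrix.J l ℝ *ᵥ y))) :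
    LinearMap.toMatrix' ((B.symm.toLinearEquiv : E →ₗ[ℝ] (l ⊕ l → ℝ)) ∘ₗ
      (LinearMap.id : E →ₗ[ℝ] E) ∘ₗ (B.toLinearEquiv : (l ⊕ l → ℝ) →ₗ[ℝ] E)) ∈
      Matrix.symplecticGroup l ℝ :=
  (preserves_iff_mem_symplecticGroup η B hB LinearMap.id).1 fun _ _ ↦ rfl

end Symplectic

/-! ### Riemann forms -/

section RiemannForm

variable {ι : Type*} {Φ : (ι → ℝ) ≃L[ℝ] E} {η : E [⋀^Fin 2]→L[ℝ] ℝ}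

/-- A Riemann form admits an `H`-orthonormal `ℂ`-basis of `E`.
[cite: Lange2023AbelianVarietiesComplex, §2.1.1 (positive definite `H`, pp. 75–76)] -/
theorem IsRiemannForm.exists_basis_hermOf_orthonormal [FiniteDimensional ℂ E]
    (hη : IsRiemannForm Φ η) :
    ∃ u : Basis (Fin (finrank ℂ E)) ℂ E, ∀ a b, hermOf η (u a) (u b) = if a = b then 1 else 0 :=
  ComplexTorus.exists_basis_hermOf_orthonormal η hη.1 hη.2.2

/-- A Riemann form admits an adapted symplectic real basis: `η(Bx, By) = -ᵗx J y`, `i = -J`.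
[cite: Lange2023AbelianVarietiesComplex, §7.3.2 Lemma 7.3.7 (p. 338)] -/
theorem IsRiemannForm.exists_adaptedSymplecticBasis [FiniteDimensional ℂ E]
    (hη : IsRiemannForm Φ η) :
    ∃ B : (Fin (finrank ℂ E) ⊕ Fin (finrank ℂ E) → ℝ) ≃L[ℝ] E,
      (∀ x y, η ![B x, B y] = -(x ⬝ᵥ (Matrix.J (Fin (finrank ℂ E)) ℝ *ᵥ y))) ∧
        ∀ x, I • B x = B (-(Matrix.J (Fin (finrank ℂ E)) ℝ *ᵥ x)) :=
  ComplexTorus.exists_adaptedSymplecticBasis η hη.1 hη.2.2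

end RiemannForm

/-! ### Validation instance: the elliptic curve `ℂ/(ℤ + τℤ)` -/

section Elliptic

variable {τ : ℂ}

/-- **`H_τ(v, w) = v w̄ / Im τ`** for the principal polarisation `E(v, w) = Im(v w̄)/Im τ` of
`E_τ = ℂ/(ℤ + τℤ)` (Example 2.1.3).
[cite: Lange2023AbelianVarietiesComplex, §2.1.1 Example 2.1.3] -/
theorem hermOf_ellipticForm (hτ : τ.im ≠ 0) (v w : ℂ) :
    hermOf (ellipticForm hτ) v w = v * conj w / τ.im := by
  rw [hermOf_apply, smul_eq_mul, ellipticForm_apply, ellipticForm_apply]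
  apply Complex.ext
  · simp [Complex.div_ofReal_re, add_comm]
  · simp [Complex.div_ofReal_im]

/-- The vector `u₁ = √(Im τ)` is `H_τ`-orthonormal: `H_τ(√Im τ, √Im τ) = 1` (`Im τ > 0`) — the
`g = 1` instance of `exists_basis_hermOf_orthonormal`.
[cite: Lange2023AbelianVarietiesComplex, §2.1.1 Example 2.1.3] -/
theorem hermOf_ellipticForm_sqrt_im (hτ : 0 < τ.im) :
    hermOf (ellipticForm hτ.ne') (Real.sqrt τ.im) (Real.sqrt τ.im) = 1 := by
  rw [hermOf_ellipticForm, Complex.conj_ofReal, ← Complex.ofReal_mul,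
    Real.mul_self_sqrt hτ.le, div_self (Complex.ofReal_ne_zero.2 hτ.ne')]

/-- The adapted symplectic basis `(e₁, f₁) = (i√Im τ, √Im τ)` of `(ℂ, E_τ)`:
`E(e₁, f₁) = 1`, `E(e₁, e₁) = E(f₁, f₁) = 0`, `i e₁ = -f₁`, `i f₁ = e₁` — the `g = 1` instance of
`exists_adaptedSymplecticBasis`. [cite: Lange2023AbelianVarietiesComplex, §2.1.1 Example 2.1.3] -/
theorem ellipticForm_adaptedFrame (hτ : 0 < τ.im) :
    ellipticForm hτ.ne' ![I * Real.sqrt τ.im, Real.sqrt τ.im] = 1 ∧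
      ellipticForm hτ.ne' ![I * Real.sqrt τ.im, I * Real.sqrt τ.im] = 0 ∧
      ellipticForm hτ.ne' ![(Real.sqrt τ.im : ℂ), Real.sqrt τ.im] = 0 ∧
      I * (I * Real.sqrt τ.im) = -(Real.sqrt τ.im : ℂ) := by
  have hs : Real.sqrt τ.im * Real.sqrt τ.im = τ.im := Real.mul_self_sqrt hτ.le
  refine ⟨?_, ?_, ?_, ?_⟩
  · rw [ellipticForm_apply]
    simp only [Complex.conj_ofReal, mul_im, I_re, I_im, ofReal_re, ofReal_im, mul_re]
    field_simp
    nlinarith [hs]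
  · exact twoForm_self _ _
  · exact twoForm_self _ _
  · rw [← mul_assoc, Complex.I_mul_I, neg_one_mul]

end Elliptic

end ComplexTorus

end Literature.Geometry.Kaehler

end
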